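import Summits.AtomisticToContinuum.FouriersLaw.Theorems.JunctionLocalityNonBallisticStubColumnFlatGreenKuboAux1
import Summits.AtomisticToContinuum.FouriersLaw.Theorems.BondHeatUncertaintySubdiffusiveBondHeatSiteEnergyDynkinTruncation

/-!
# `NonBallistic` / column-flat Green–Kubo matrix, part 2: Dynkin's identity for an interior split site energy

Helper file for crux `stmt-AtomisticToContinuum-9127` (`JunctionLocality.NonBallistic`), line
`contact-current-forgetting`, stub `stub_columnFlatGreenKubo`. For the pinned anharmonic chain
`pinnedChain ω₂ lam β γ` (`ω₂, β, γ > 0`, `lam ≥ 0`), equal bath temperatures `T > 0`, the CONSTRUCTED transition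
kernels `P_t = OscillatorChain.transitionKernel N T T t` and three consecutive sites `a, b, c` (so `b` is an
interior site) with split site energy `ẽ_b = p_b²/2 + U(q_b) + ½V(q_c - q_b) + ½V(q_b - q_a)`:

  `P_r ẽ_b(z) - ẽ_b(z) = ∫₀ʳ P_s(j_a - j_b)(z) ds`        (`pinnedChain_splitSiteEnergy_dynkin`)

(the pointwise generator identity `L ẽ_b = j_a - j_b` is `pinnedChain_generator_splitSiteEnergy`, part 1).
Proof: exactly as for the bath-site energy (`stub_siteEnergyDynkin`): the truncations `ẽ_b χ(H/R)` are `C²_c`,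
their generator is `χ(H/R) Lẽ_b + ẽ_b Lχ_R` (`generator_mul_smoothCutoff_hamiltonian`; the carré-du-champ term
vanishes because `∂_{p_0} ẽ_b = ∂_{p_{N-1}} ẽ_b = 0` at an interior site), `|ẽ_b Lχ_R| ≤ (A/R)(1 + H)²`
(`pinnedChain_abs_generator_truncSplitSiteEnergy_sub_le`), and the truncation lemma
`pinnedChain_dynkin_of_truncation` (dominated convergence through CEHR (3.4)) applies with the weight `e^{H/(2T)}`.

Nothing here closes an item.
-/

noncomputable section

open MeasureTheory ProbabilityTheory Filter Topology Set
open scoped NNReal ENNReal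

namespace Summit.AtomisticToContinuum.FouriersLaw.Theorems.NonBallistic

open Literature.MathematicalPhysics.KineticTheory.HeatConduction
open Literature.MathematicalPhysics.KineticTheory Literature.Probability.Process OscillatorChain
open Summit.AtomisticToContinuum.FouriersLaw.Theorems.SubdiffusiveBondHeat

variable {N : ℕ}

/-! ### The truncation error for the split site energy -/

section TruncError

variable {ω₂ lam β γ : ℝ}

/-- **The truncation error for an interior split site energy.** For the pinned chain (`ω₂, lam, β, γ ≥ 0`,
equal bath temperatures `T ≥ 0`) and three consecutive sites `a, b, c` there is `A ≥ 0` with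
`|L(ẽ_b χ(H/R)) - χ(H/R) Lẽ_b| ≤ (A/R) (1 + H)²` on phase space for all `R ≥ 1`: by
`generator_mul_smoothCutoff_hamiltonian` the difference is `ẽ_b Lχ_R + Γ(ẽ_b, χ_R)`, where `Γ(ẽ_b, χ_R) = 0`
(`∂_{p_0}ẽ_b = ∂_{p_{N-1}}ẽ_b = 0`, `b ∉ {0, N-1}`), `|χ'|, |χ''|` are bounded, `ẽ_b ≤ 2H`, `p_0² + p²_{N-1} ≤ 2H`.
[folklore] -/
theorem pinnedChain_abs_generator_truncSplitSiteEnergy_sub_le (hω : 0 ≤ ω₂) (hl : 0 ≤ lam) (hβ : 0 ≤ β)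
    (hγ : 0 ≤ γ) {a b c : Fin N} (hab : b.val = a.val + 1) (hbc : c.val = b.val + 1) {T : ℝ} (hT : 0 ≤ T) :
    ∃ A : ℝ, 0 ≤ A ∧ ∀ R : ℝ, 1 ≤ R → ∀ x : PhaseSpace N,
      |(pinnedChain ω₂ lam β γ).generator N T T (fun y =>
            ((y.2 b) ^ 2 / 2 + (pinnedChain ω₂ lam β γ).U (y.1 b) + (pinnedChain ω₂ lam β γ).V (y.1 c - y.1 b) / 2 +
              (pinnedChain ω₂ lam β γ).V (y.1 b - y.1 a) / 2) *
            smoothCutoff ((pinnedChain ω₂ lam β γ).hamiltonian N y / R)) x -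
          smoothCutoff ((pinnedChain ω₂ lam β γ).hamiltonian N x / R) *
            (pinnedChain ω₂ lam β γ).generator N T T (fun y =>
              (y.2 b) ^ 2 / 2 + (pinnedChain ω₂ lam β γ).U (y.1 b) + (pinnedChain ω₂ lam β γ).V (y.1 c - y.1 b) / 2 +
                (pinnedChain ω₂ lam β γ).V (y.1 b - y.1 a) / 2) x| ≤
        A / R * (1 + (pinnedChain ω₂ lam β γ).hamiltonian N x) ^ 2 := by
  obtain ⟨M₁, hM₁0, hM₁⟩ := exists_bound_deriv_smoothCutoff
  obtain ⟨M₂, hM₂0, hM₂⟩ := exists_bound_deriv_deriv_smoothCutoff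
  refine ⟨γ * (4 * M₁ * T + 4 * M₁ + 4 * M₂ * T), by positivity, fun R hR x => ?_⟩
  have hN0 : 0 < N := by have := c.isLt; omega
  have hN1 : N - 1 < N := Nat.sub_lt hN0 one_pos
  have hR0 : 0 < R := lt_of_lt_of_le one_pos hR
  have hTγ : 0 ≤ (pinnedChain ω₂ lam β γ).γ * T := mul_nonneg hγ hT
  have hU2 : ContDiff ℝ 2 (pinnedChain ω₂ lam β γ).U := pinnedChain_contDiff_U ω₂ lam β γ
  have hV2 : ContDiff ℝ 2 (pinnedChain ω₂ lam β γ).V := pinnedChain_contDiff_V ω₂ lam β γ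
  have he2 := contDiff_splitSiteEnergy (pinnedChain ω₂ lam β γ) (a := a) (b := b) (c := c) hU2 hV2
  have h0b : (⟨0, hN0⟩ : Fin N) ≠ b := by
    intro h; have := congrArg Fin.val h; simp only at this; omega
  have hNb : (⟨N - 1, hN1⟩ : Fin N) ≠ b := by
    intro h; have := congrArg Fin.val h; simp only at this; have := c.isLt; omega
  have hne : (⟨0, hN0⟩ : Fin N) ≠ ⟨N - 1, hN1⟩ := by
    intro h; have := congrArg Fin.val h; simp only at this; have := c.isLt; omega
  have hγ' : (pinnedChain ω₂ lam β γ).γ = γ := rfl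
  rw [generator_mul_smoothCutoff_hamiltonian hU2 hV2 hN0 hTγ hTγ he2 R x,
    partialP_splitSiteEnergy (pinnedChain ω₂ lam β γ), partialP_splitSiteEnergy (pinnedChain ω₂ lam β γ),
    if_neg h0b, if_neg hNb, hγ', add_sub_cancel_left]
  -- the elementary bounds
  obtain ⟨hE0, hEH⟩ := pinnedChain_splitSiteEnergy_nonneg_le hω hl hβ γ hab hbc x
  have hH0 : 0 ≤ (pinnedChain ω₂ lam β γ).hamiltonian N x := pinnedChain_hamiltonian_nonneg hω hl hβ γ N x
  have habH : x.2 ⟨0, hN0⟩ ^ 2 + x.2 ⟨N - 1, hN1⟩ ^ 2 ≤ 2 * (pinnedChain ω₂ lam β γ).hamiltonian N x := by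
    have := pinnedChain_sq_add_sq_le_hamiltonian hω hl hβ γ N x hne
    linarith
  have hχ₁b := hM₁ ((pinnedChain ω₂ lam β γ).hamiltonian N x / R)
  have hχ₂b := hM₂ ((pinnedChain ω₂ lam β γ).hamiltonian N x / R)
  -- make the atoms opaque
  generalize deriv smoothCutoff ((pinnedChain ω₂ lam β γ).hamiltonian N x / R) = χ₁ at hχ₁b ⊢
  generalize deriv (deriv smoothCutoff) ((pinnedChain ω₂ lam β γ).hamiltonian N x / R) = χ₂ at hχ₂b ⊢
  generalize (x.2 b) ^ 2 / 2 + (pinnedChain ω₂ lam β γ).U (x.1 b) + (pinnedChain ω₂ lam β γ).V (x.1 c - x.1 b) / 2 +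
    (pinnedChain ω₂ lam β γ).V (x.1 b - x.1 a) / 2 = E at hE0 hEH ⊢
  generalize (pinnedChain ω₂ lam β γ).hamiltonian N x = Hx at hH0 habH hEH ⊢
  generalize x.2 ⟨0, hN0⟩ = p at habH ⊢
  generalize x.2 ⟨N - 1, hN1⟩ = q at habH ⊢
  -- real arithmetic: everything carries a factor `γ/R`
  have hb0 : 0 ≤ q ^ 2 := sq_nonneg _
  have ha0 : 0 ≤ p ^ 2 := sq_nonneg _
  have key : E * (γ * (χ₁ / R * (T + T - p ^ 2 - q ^ 2) + χ₂ / R ^ 2 * (T * p ^ 2 + T * q ^ 2))) +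
      χ₁ / R * (2 * γ * T * p * 0 + 2 * γ * T * q * 0) =
      γ / R * (E * (χ₁ * (2 * T - p ^ 2 - q ^ 2) + χ₂ * T * (p ^ 2 + q ^ 2) / R)) := by
    field_simp; ring
  have hin : |E * (χ₁ * (2 * T - p ^ 2 - q ^ 2) + χ₂ * T * (p ^ 2 + q ^ 2) / R)| ≤
      E * (M₁ * (2 * T + p ^ 2 + q ^ 2) + M₂ * T * (p ^ 2 + q ^ 2)) := by
    have h1 : |χ₁ * (2 * T - p ^ 2 - q ^ 2)| ≤ M₁ * (2 * T + p ^ 2 + q ^ 2) := by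
      rw [abs_mul]
      refine mul_le_mul hχ₁b ?_ (abs_nonneg _) hM₁0
      rw [abs_le]; constructor <;> linarith
    have h2 : |χ₂ * T * (p ^ 2 + q ^ 2) / R| ≤ M₂ * T * (p ^ 2 + q ^ 2) := by
      rw [abs_div, abs_mul, abs_mul, abs_of_nonneg hT, abs_of_nonneg (add_nonneg ha0 hb0), abs_of_pos hR0]
      calc |χ₂| * T * (p ^ 2 + q ^ 2) / R ≤ |χ₂| * T * (p ^ 2 + q ^ 2) / 1 :=
            div_le_div_of_nonneg_left (by positivity) one_pos hR
        _ ≤ M₂ * T * (p ^ 2 + q ^ 2) := by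
            rw [div_one]
            exact mul_le_mul_of_nonneg_right (mul_le_mul_of_nonneg_right hχ₂b hT) (add_nonneg ha0 hb0)
    calc |E * (χ₁ * (2 * T - p ^ 2 - q ^ 2) + χ₂ * T * (p ^ 2 + q ^ 2) / R)|
        = E * |χ₁ * (2 * T - p ^ 2 - q ^ 2) + χ₂ * T * (p ^ 2 + q ^ 2) / R| := by
          rw [abs_mul, abs_of_nonneg hE0]
      _ ≤ E * (|χ₁ * (2 * T - p ^ 2 - q ^ 2)| + |χ₂ * T * (p ^ 2 + q ^ 2) / R|) := by
          gcongr
          exact abs_add_le _ _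
      _ ≤ E * (M₁ * (2 * T + p ^ 2 + q ^ 2) + M₂ * T * (p ^ 2 + q ^ 2)) := by
          gcongr
  have hpoly : E * (M₁ * (2 * T + p ^ 2 + q ^ 2) + M₂ * T * (p ^ 2 + q ^ 2)) ≤
      (4 * M₁ * T + 4 * M₁ + 4 * M₂ * T) * (1 + Hx) ^ 2 := by
    have s1 : E * (M₁ * (2 * T + p ^ 2 + q ^ 2) + M₂ * T * (p ^ 2 + q ^ 2)) ≤
        (2 * Hx) * (M₁ * (2 * T + 2 * Hx) + M₂ * T * (2 * Hx)) := by
      refine mul_le_mul hEH ?_ (by positivity) (by positivity)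
      have := mul_nonneg hM₂0 hT
      nlinarith
    nlinarith [mul_nonneg hM₁0 hT, mul_nonneg (mul_nonneg hM₁0 hT) hH0, mul_nonneg hM₁0 hH0,
      mul_nonneg (mul_nonneg hM₁0 hT) (sq_nonneg Hx), mul_nonneg hM₂0 hT,
      mul_nonneg (mul_nonneg hM₂0 hT) hH0]
  rw [key, abs_mul, abs_div, abs_of_nonneg hγ, abs_of_pos hR0]
  calc γ / R * |E * (χ₁ * (2 * T - p ^ 2 - q ^ 2) + χ₂ * T * (p ^ 2 + q ^ 2) / R)|
      ≤ γ / R * (E * (M₁ * (2 * T + p ^ 2 + q ^ 2) + M₂ * T * (p ^ 2 + q ^ 2))) :=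
        mul_le_mul_of_nonneg_left hin (div_nonneg hγ hR0.le)
    _ ≤ γ / R * ((4 * M₁ * T + 4 * M₁ + 4 * M₂ * T) * (1 + Hx) ^ 2) :=
        mul_le_mul_of_nonneg_left hpoly (div_nonneg hγ hR0.le)
    _ = γ * (4 * M₁ * T + 4 * M₁ + 4 * M₂ * T) / R * (1 + Hx) ^ 2 := by ring

end TruncError

/-! ### Dynkin's identity for the split site energy -/

section Main

variable {ω₂ lam β γ : ℝ}

/-- **Dynkin's identity for an interior split site energy of the pinned anharmonic chain.** For
`pinnedChain ω₂ lam β γ` (`ω₂, β, γ > 0`, `lam ≥ 0`), equal bath temperatures `T > 0`, the constructed transition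
kernels `P_t = OscillatorChain.transitionKernel N T T t`, three consecutive sites `a, b, c` and
`ẽ_b = p_b²/2 + U(q_b) + ½V(q_c - q_b) + ½V(q_b - q_a)`:
`P_r ẽ_b(z) - ẽ_b(z) = ∫₀ʳ P_s(j_a - j_b)(z) ds` for all `r ≥ 0` and `z` — Dynkin's formula for the polynomially
bounded observable `ẽ_b`, `Lẽ_b = j_a - j_b` (`pinnedChain_generator_splitSiteEnergy`), from the `C²_c` case by the
truncations `ẽ_b χ(H/R)` (`pinnedChain_dynkin_of_truncation`, `pinnedChain_abs_generator_truncSplitSiteEnergy_sub_le`),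
all error terms being `O((1 + H)²/R) = O(e^{H/(2T)}/R)` and the kernels integrating `e^{H/(2T)}` (CEHR (3.4)).
[cite: CuneoEckmannHairerReyBellet2018, §3 eq. (3.2)–(3.4)] -/
theorem pinnedChain_splitSiteEnergy_dynkin :
    ∀ {ω₂ lam β γ : ℝ}, 0 < ω₂ → 0 ≤ lam → 0 < β → 0 < γ → ∀ {N : ℕ} {T : ℝ}, 0 < T →
      ∀ {a b c : Fin N}, b.val = a.val + 1 → c.val = b.val + 1 → ∀ (r : NNReal) (z : PhaseSpace N),
      ∫ y, ((y.2 b) ^ 2 / 2 + (pinnedChain ω₂ lam β γ).U (y.1 b) + (pinnedChain ω₂ lam β γ).V (y.1 c - y.1 b) / 2 +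
            (pinnedChain ω₂ lam β γ).V (y.1 b - y.1 a) / 2) ∂((pinnedChain ω₂ lam β γ).transitionKernel N T T r z) -
          ((z.2 b) ^ 2 / 2 + (pinnedChain ω₂ lam β γ).U (z.1 b) + (pinnedChain ω₂ lam β γ).V (z.1 c - z.1 b) / 2 +
            (pinnedChain ω₂ lam β γ).V (z.1 b - z.1 a) / 2) =
        ∫ s in (0 : ℝ)..(r : ℝ), ∫ y, ((pinnedChain ω₂ lam β γ).bondCurrent N a y -
            (pinnedChain ω₂ lam β γ).bondCurrent N b y)
          ∂((pinnedChain ω₂ lam β γ).transitionKernel N T T s.toNNReal z) := by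
  intro ω₂ lam β γ hω hl hβ hγ N T hT a b c hab hbc r z
  have hN0 : 0 < N := by have := c.isLt; omega
  -- the constants
  obtain ⟨A, hA0, hA⟩ := pinnedChain_abs_generator_truncSplitSiteEnergy_sub_le hω.le hl hβ.le hγ.le hab hbc hT.le
  set θ : ℝ := 1 / (2 * T) with hθ
  have hθ0 : 0 < θ := by positivity
  have hθ1 : θ < 1 / T := by
    rw [hθ, div_lt_div_iff₀ (by positivity) hT]; nlinarith
  set B : ℝ := N * ((3 + β) / 2) + N * ((3 + β) / 2) with hB
  have hB0 : 0 ≤ B := by positivity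
  set C₀ : ℝ := 2 * Real.exp θ / θ ^ 2 with hC₀
  have hC₀0 : 0 ≤ C₀ := by positivity
  -- the observable, its generator image, the truncations
  set e : PhaseSpace N → ℝ := fun y => (y.2 b) ^ 2 / 2 + (pinnedChain ω₂ lam β γ).U (y.1 b) +
    (pinnedChain ω₂ lam β γ).V (y.1 c - y.1 b) / 2 + (pinnedChain ω₂ lam β γ).V (y.1 b - y.1 a) / 2 with he
  set ℓ : PhaseSpace N → ℝ := fun y => (pinnedChain ω₂ lam β γ).bondCurrent N a y -
    (pinnedChain ω₂ lam β γ).bondCurrent N b y with hℓ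
  set f : ℕ → PhaseSpace N → ℝ := fun n y =>
    e y * smoothCutoff ((pinnedChain ω₂ lam β γ).hamiltonian N y / (n + 1)) with hf
  have hfdef : ∀ n y, f n y = e y * smoothCutoff ((pinnedChain ω₂ lam β γ).hamiltonian N y / (n + 1)) :=
    fun n y => rfl
  -- regularity and compact support
  have hU2 : ContDiff ℝ 2 (pinnedChain ω₂ lam β γ).U := pinnedChain_contDiff_U ω₂ lam β γ
  have hV2 : ContDiff ℝ 2 (pinnedChain ω₂ lam β γ).V := pinnedChain_contDiff_V ω₂ lam β γ
  have he2 : ContDiff ℝ 2 e := contDiff_splitSiteEnergy (pinnedChain ω₂ lam β γ) hU2 hV2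
  have hH2 : ContDiff ℝ 2 ((pinnedChain ω₂ lam β γ).hamiltonian N) :=
    (pinnedChain ω₂ lam β γ).contDiff_hamiltonian hU2 hV2 N
  have hH0 : ∀ y, 0 ≤ (pinnedChain ω₂ lam β γ).hamiltonian N y := fun y =>
    pinnedChain_hamiltonian_nonneg hω.le hl hβ.le γ N y
  have hRpos : ∀ n : ℕ, (0:ℝ) < n + 1 := fun n => by positivity
  have hR1 : ∀ n : ℕ, (1:ℝ) ≤ n + 1 := fun n => by
    have : (0:ℝ) ≤ n := Nat.cast_nonneg n
    linarith
  have hf2 : ∀ n, ContDiff ℝ 2 (f n) := fun n =>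
    he2.mul ((contDiff_smoothCutoff (n := 2)).comp (hH2.div_const _))
  have hfs : ∀ n, HasCompactSupport (f n) := fun n => by
    refine HasCompactSupport.intro
      (pinnedChain_isCompact_setOf_hamiltonian_le hω hl hβ.le γ N (2 * (n + 1))) fun y hy => ?_
    simp only [mem_setOf_eq, not_le] at hy
    have h2 : 2 ≤ (pinnedChain ω₂ lam β γ).hamiltonian N y / (n + 1) := by
      rw [le_div_iff₀ (hRpos n)]; linarith
    rw [hfdef, smoothCutoff_of_two_le h2, mul_zero]
  -- the generator image of `e` is `ℓ`
  have hgen : ∀ x, (pinnedChain ω₂ lam β γ).generator N T T e x = ℓ x := fun x =>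
    pinnedChain_generator_splitSiteEnergy ω₂ lam β γ T T N a b c hab hbc x
  -- eventually the cutoff is `1`
  have hev : ∀ y, ∀ᶠ n : ℕ in atTop, smoothCutoff ((pinnedChain ω₂ lam β γ).hamiltonian N y / (n + 1)) = 1 := by
    intro y
    obtain ⟨n₀, hn₀⟩ := exists_nat_ge ((pinnedChain ω₂ lam β γ).hamiltonian N y)
    filter_upwards [eventually_ge_atTop n₀] with n hn
    have h1 : (pinnedChain ω₂ lam β γ).hamiltonian N y / (n + 1) ≤ 1 := by
      rw [div_le_one (hRpos n)]
      have : (n₀ : ℝ) ≤ n := by exact_mod_cast hn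
      linarith
    exact smoothCutoff_of_le_one h1
  -- size estimates
  have hsq : ∀ y, (1 + (pinnedChain ω₂ lam β γ).hamiltonian N y) ^ 2 ≤
      C₀ * Real.exp (θ * (pinnedChain ω₂ lam β γ).hamiltonian N y) := fun y => one_add_sq_le_exp (hH0 y) hθ0
  have hebd : ∀ y, 0 ≤ e y ∧ e y ≤ 2 * (pinnedChain ω₂ lam β γ).hamiltonian N y := fun y =>
    pinnedChain_splitSiteEnergy_nonneg_le hω.le hl hβ.le γ hab hbc y
  have hℓb : ∀ y, |ℓ y| ≤ B * (1 + (pinnedChain ω₂ lam β γ).hamiltonian N y) ^ 2 := fun y => by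
    have hja := pinnedChain_abs_bondCurrent_le hω.le hl hβ.le γ N a y
    have hjb := pinnedChain_abs_bondCurrent_le hω.le hl hβ.le γ N b y
    rw [hℓ]
    dsimp only
    calc |(pinnedChain ω₂ lam β γ).bondCurrent N a y - (pinnedChain ω₂ lam β γ).bondCurrent N b y|
        ≤ |(pinnedChain ω₂ lam β γ).bondCurrent N a y| + |(pinnedChain ω₂ lam β γ).bondCurrent N b y| :=
          abs_sub _ _
      _ ≤ N * ((3 + β) / 2 * (1 + (pinnedChain ω₂ lam β γ).hamiltonian N y) ^ 2) +
          N * ((3 + β) / 2 * (1 + (pinnedChain ω₂ lam β γ).hamiltonian N y) ^ 2) := add_le_add hja hjb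
      _ = B * (1 + (pinnedChain ω₂ lam β γ).hamiltonian N y) ^ 2 := by rw [hB]; ring
  -- the truncation error, with `Le = ℓ`
  have herr : ∀ (n : ℕ) (y : PhaseSpace N),
      |(pinnedChain ω₂ lam β γ).generator N T T (f n) y -
          smoothCutoff ((pinnedChain ω₂ lam β γ).hamiltonian N y / (n + 1)) * ℓ y| ≤
        A / (n + 1) * (1 + (pinnedChain ω₂ lam β γ).hamiltonian N y) ^ 2 := by
    intro n y
    have h : |(pinnedChain ω₂ lam β γ).generator N T T (f n) y -
        smoothCutoff ((pinnedChain ω₂ lam β γ).hamiltonian N y / (n + 1)) *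
          (pinnedChain ω₂ lam β γ).generator N T T e y| ≤
        A / (n + 1) * (1 + (pinnedChain ω₂ lam β γ).hamiltonian N y) ^ 2 := hA (n + 1) (hR1 n) y
    rw [hgen y] at h
    exact h
  -- the uniform exponential domination of `f_n` and `L f_n`
  have hfb : ∀ (n : ℕ) (y : PhaseSpace N),
      |f n y| ≤ (A + B + 2) * C₀ * Real.exp (θ * (pinnedChain ω₂ lam β γ).hamiltonian N y) := by
    intro n y
    obtain ⟨h0, h1⟩ := hebd y
    have hχ0 := smoothCutoff_nonneg ((pinnedChain ω₂ lam β γ).hamiltonian N y / (n + 1))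
    have hχ1 := smoothCutoff_le_one ((pinnedChain ω₂ lam β γ).hamiltonian N y / (n + 1))
    have hs := hsq y
    have hHy := hH0 y
    rw [hfdef, abs_of_nonneg (mul_nonneg h0 hχ0)]
    generalize (pinnedChain ω₂ lam β γ).hamiltonian N y = Hy at h1 hs hHy hχ0 hχ1 ⊢
    generalize smoothCutoff (Hy / (n + 1)) = c' at hχ0 hχ1 ⊢
    generalize e y = E at h0 h1 ⊢
    calc E * c' ≤ E := mul_le_of_le_one_right h0 hχ1
      _ ≤ 2 * (1 + Hy) ^ 2 := by nlinarith
      _ ≤ (A + B + 2) * (1 + Hy) ^ 2 := by gcongr; linarith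
      _ ≤ (A + B + 2) * (C₀ * Real.exp (θ * Hy)) := by gcongr
      _ = (A + B + 2) * C₀ * Real.exp (θ * Hy) := by ring
  have hLb : ∀ (n : ℕ) (y : PhaseSpace N), |(pinnedChain ω₂ lam β γ).generator N T T (f n) y| ≤
      (A + B + 2) * C₀ * Real.exp (θ * (pinnedChain ω₂ lam β γ).hamiltonian N y) := by
    intro n y
    have h1 := herr n y
    have h2 := hℓb y
    have hs := hsq y
    have hHy := hH0 y
    have hχ0 := smoothCutoff_nonneg ((pinnedChain ω₂ lam β γ).hamiltonian N y / (n + 1))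
    have hχ1 := smoothCutoff_le_one ((pinnedChain ω₂ lam β γ).hamiltonian N y / (n + 1))
    generalize (pinnedChain ω₂ lam β γ).generator N T T (f n) y = G at h1 ⊢
    generalize (pinnedChain ω₂ lam β γ).hamiltonian N y = Hy at h1 h2 hs hHy hχ0 hχ1 ⊢
    generalize smoothCutoff (Hy / (n + 1)) = c' at hχ0 hχ1 h1 ⊢
    generalize ℓ y = l at h1 h2 ⊢
    have h3 : |c' * l| ≤ B * (1 + Hy) ^ 2 := by
      rw [abs_mul, abs_of_nonneg hχ0]
      calc c' * |l| ≤ 1 * |l| := mul_le_mul_of_nonneg_right hχ1 (abs_nonneg _)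
        _ ≤ B * (1 + Hy) ^ 2 := by rw [one_mul]; exact h2
    have h4 : A / (n + 1) * (1 + Hy) ^ 2 ≤ A * (1 + Hy) ^ 2 :=
      mul_le_mul_of_nonneg_right (div_le_self hA0 (hR1 n)) (sq_nonneg _)
    calc |G| ≤ |G - c' * l| + |c' * l| := by
          have := abs_add_le (G - c' * l) (c' * l); rwa [sub_add_cancel] at this
      _ ≤ A * (1 + Hy) ^ 2 + B * (1 + Hy) ^ 2 := add_le_add (h1.trans h4) h3
      _ ≤ (A + B + 2) * (1 + Hy) ^ 2 := by nlinarith [sq_nonneg (1 + Hy)]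
      _ ≤ (A + B + 2) * (C₀ * Real.exp (θ * Hy)) := by gcongr
      _ = (A + B + 2) * C₀ * Real.exp (θ * Hy) := by ring
  -- pointwise convergence of `f_n` and `L f_n`
  have hfe : ∀ y, Tendsto (fun n => f n y) atTop (𝓝 (e y)) := fun y => by
    refine tendsto_const_nhds.congr' ?_
    filter_upwards [hev y] with n hn
    rw [hfdef, hn, mul_one]
  have hfℓ : ∀ y, Tendsto (fun n => (pinnedChain ω₂ lam β γ).generator N T T (f n) y) atTop (𝓝 (ℓ y)) := by
    intro y
    have hg : Tendsto (fun n : ℕ => smoothCutoff ((pinnedChain ω₂ lam β γ).hamiltonian N y / (n + 1)) * ℓ y)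
        atTop (𝓝 (ℓ y)) := by
      refine tendsto_const_nhds.congr' ?_
      filter_upwards [hev y] with n hn
      rw [hn, one_mul]
    have hd : Tendsto (fun n : ℕ => (pinnedChain ω₂ lam β γ).generator N T T (f n) y -
        smoothCutoff ((pinnedChain ω₂ lam β γ).hamiltonian N y / (n + 1)) * ℓ y) atTop (𝓝 0) := by
      have hCn : Tendsto (fun n : ℕ => A / (n + 1) * (1 + (pinnedChain ω₂ lam β γ).hamiltonian N y) ^ 2)
          atTop (𝓝 0) := by
        have h1 : Tendsto (fun n : ℕ => A / ((n : ℝ) + 1)) atTop (𝓝 0) :=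
          tendsto_const_nhds.div_atTop (tendsto_natCast_atTop_atTop.atTop_add tendsto_const_nhds)
        simpa using h1.mul_const ((1 + (pinnedChain ω₂ lam β γ).hamiltonian N y) ^ 2)
      exact squeeze_zero_norm (fun n => by rw [Real.norm_eq_abs]; exact herr n y) hCn
    have := hd.add hg
    simpa using this
  exact pinnedChain_dynkin_of_truncation hω hl hβ hγ hN0 hT hθ0 hθ1 f hf2 hfs hfe hfℓ hfb hLb r z

end Main

end Summit.AtomisticToContinuum.FouriersLaw.Theorems.NonBallistic

end
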